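import Literature.NumberTheory.LFunctions.WeilFirstPrimeCertificateDataC
import HarnessLib

/-!
# First-prime Weil positivity, stage C: kernel check of the even scaled moments ν_36, ν_38, ν_40, ν_42, ν_44, ν_46

Part of `weilCert3C.check` (`WeilFirstPrimeCertificateDataC.lean`), evaluated by `decide +kernel` and kept in its own
file for kernel time and memory (each declaration is checked separately). Assembled in
`WeilFirstPrimeCertificateCCheck.lean`. Pure proof file; nothing is asserted.
-/

noncomputable section

namespace Literature.NumberTheory.LFunctions

set_option maxHeartbeats 0 in
/-- **Kernel check of the scaled moment `ν_{36}`** of the stage-C first-prime certificate. [folklore] -/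
theorem checkNuAt36_weilCert3C : weilCert3C.checkNuAt 36 = true := by
  decide +kernel

set_option maxHeartbeats 0 in
/-- **Kernel check of the scaled moment `ν_{38}`** of the stage-C first-prime certificate. [folklore] -/
theorem checkNuAt38_weilCert3C : weilCert3C.checkNuAt 38 = true := by
  decide +kernel

set_option maxHeartbeats 0 in
/-- **Kernel check of the scaled moment `ν_{40}`** of the stage-C first-prime certificate. [folklore] -/
theorem checkNuAt40_weilCert3C : weilCert3C.checkNuAt 40 = true := by
  decide +kernel

set_option maxHeartbeats 0 in
/-- **Kernel check of the scaled moment `ν_{42}`** of the stage-C first-prime certificate. [folklore] -/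
theorem checkNuAt42_weilCert3C : weilCert3C.checkNuAt 42 = true := by
  decide +kernel

set_option maxHeartbeats 0 in
/-- **Kernel check of the scaled moment `ν_{44}`** of the stage-C first-prime certificate. [folklore] -/
theorem checkNuAt44_weilCert3C : weilCert3C.checkNuAt 44 = true := by
  decide +kernel

set_option maxHeartbeats 0 in
/-- **Kernel check of the scaled moment `ν_{46}`** of the stage-C first-prime certificate. [folklore] -/
theorem checkNuAt46_weilCert3C : weilCert3C.checkNuAt 46 = true := by
  decide +kernel

end Literature.NumberTheory.LFunctions
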